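import Summits.ABC.IUTFork.Cor312VolumesRealAssembly
import Summits.ABC.IUTFork.Cor312SettingReal
import HarnessLib

/-!
# [IUTchIII] Corollary 3.12, statement — the `Cor312.Setting` over the REAL log-shells WITH THE VERBATIM VOLUMES:
# hull-sets admissible (`hadm`) and nonempty (`hul_nonempty`) PROVED

Record-only file (D-0012) of the abc-iut cell (Cor. 3.12 sub-crew, seat abc-iut-c312-5, gen 2; D-0067 TEAM A row
A-0; re-filed with the p414930 review revise applied by seat abc-iut-c312-3, gen 4); TAKES NO SIDE. c312-7's constructor `Cor312.Setting.ofComparison` (`Cor312SettingReal`) assembles the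
setting of the printed statement of [IUTchIII] Cor. 3.12 (kurims `paper:url-4b091feeb646` p. 173 l. 41 – p. 174
l. 19) over any `Thm311.Situation` from real-packet pieces `R` (field factors `K_i`, comparison `e`, Θ-boxes,
`q`-centre) under the hypothesis `hadm` "hull-sets `λ·𝒪_L` are admissible regions of (i) (a)" and `hfin`. THIS
file feeds it with c312-5's situation `Real.situationDHVol` (`Cor312VolumesRealAssembly`: the Dupuy–Hilado-level
real log-shells of the number field `F` WITH THE VERBATIM admissible regions and log-volume of [IUTchIII] Rmk.
3.1.1 (ii)(iii) — direct product regions over the SUMMANDS `v⃗`, normalized weighted `log μ̄`) and the FIELD-FACTOR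
pieces read through abc-iut-c312-3's chosen decompositions `ψ_{v⃗} : F_{v_0} ⊗_{ℚ_p} ⋯ ⊗_{ℚ_p} F_{v_j} ≃ Π_i L_{v⃗,i}`
(`dEquiv`; [IUTchIV] Prop. 1.4 (i) "tensor products of finitely many finite extensions of `ℚ_p` … decompose … as
direct sums of finitely many finite extensions of `ℚ_p`"): field-factor index `Σ_{v⃗} DIdx`, fields `DFac`,
comparison `x ↦ (ψ_{v⃗}(e(x)_{v⃗})_i)_{v⃗,i}`; at the archimedean place NO factor (the MODELLING CHOICE of the parent file's
trivial archimedean container `LocalPieces.trivial`; NOT Dupuy–Hilado's Def. 3.6.1, which keeps `p = ∞`), and PROVES: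

* `hadm` (`Real.hadm_DH`): the preimage of a hull-set `λ·𝒪_L = Π_{v⃗,i} λ_{v⃗,i}·𝒪_{L_{v⃗,i}}` is the direct product
  over the summands `v⃗` of `ψ_{v⃗}⁻¹(Π_i λ_{v⃗,i}·𝒪)` = `g_{v⃗}·(R_I)^∼` (`g_{v⃗} = ψ_{v⃗}⁻¹(λ_{v⃗})`), each of positive
  finite normalised Haar measure (abc-iut-c312-3 `packetAdm_smul_normalizedPacket`) — so ADMISSIBLE in the
  verbatim container ([IUTchIII] Rmk. 3.9.5 (ii): hull-sets are regions; Rmk. 3.1.1 (iii));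
* hence **`Real.settingDHVol`**: a `Cor312.Setting` over `Real.situationDHVol` with concrete volumes, frames,
  `q`-image and Θ-images, whose REMAINING binders are the context data `lat`/`sig`/`split`/`qData`, the Θ-boxes
  `thetaBox` (owner c312-3 `Ind3Datum`), the `q`-centre `qCentre` with `hq` (the `2l`-th root `q̲_v`), and `hfin`;
* `hul_nonempty` for it (admissible ⇒ nonempty), whence **`Real.bridgeHyps_settingDHVol`**: c312-6's `BridgeHyps`
  with `mono`, `image_adm`, `image_fin`, `hul_nonempty`, `theta_nonempty` DISCHARGED — inputs left: the
  (Ind3)-region admissible with finitely supported log-volume, and `ThetaFinite` (c312-7 `hullDefined_of_stable`).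
[claim: Mochizuki2012, status: disputed] for the quoted setting; [cite: DupuyHilado2025, Def. 3.6.1];
[cite: Mochizuki2012, IUTchIV Prop. 1.4 (i) p. 13]. Deliberately NOT here: Θ-boxes, `IsSettingOf` (c312-8),
any judgement.
-/

noncomputable section

open Set Function NumberField IsDedekindDomain
open scoped Pointwise

namespace Summit.ABC

namespace IUTFork

namespace Cor312Vol

namespace PadicPresentation

open Thm311 Literature.IUT.LogThetaLattice Literature.IUT.LogVolume

variable {T : ThetaIndex} {L : LogShells T} {vQ : T.VQ} {p : ℕ} [Fact p.Prime] (P : PadicPresentation L vQ p)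

/-! ## Field factors of the real prime packets (abc-iut-c312-3's chosen decompositions `ψ_{v⃗}`) -/

/-- The field-factor index of the packet at `(j, v_ℚ)`: pairs `(v⃗, i)`, `i` indexing the fields of c312-3's
decomposition `ψ_{v⃗} : X_{v⃗} ≃ Π_i L_{v⃗,i}` ([IUTchIV] Prop. 1.4 (i)). [cite: Mochizuki2012, IUTchIV Prop. 1.4 (i) p. 13] -/
abbrev factorIdx (j : T.Label) : Type := Σ e : T.Caps j → T.Fibre vQ, DIdx p (P.kk e)

/-- The field factor `L_{v⃗,i}` (c312-3 `DFac`, a finite extension of `ℚ_p` inside `ℚ̄_p`). [cite: Mochizuki2012, IUTchIV Prop. 1.4 (i) p. 13] -/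
abbrev factorField (j : T.Label) (s : P.factorIdx j) : Type := DFac p (P.kk s.1) s.2

/-- The field-factor comparison `x ↦ (ψ_{v⃗}(e(x)_{v⃗})_i)_{(v⃗,i)}`. [claim: Mochizuki2012, status: disputed] -/
def factorMap (j : T.Label) (x : L.Packet j vQ) (s : P.factorIdx j) : P.factorField j s :=
  dEquiv p (P.kk s.1) (P.comparison j x s.1) s.2

/-- **`ψ⁻¹(λ·𝒪_L)` has positive finite Haar measure**: the preimage under c312-3's decomposition `ψ_{v⃗}` of a
hull-set `Π_i λ_i·𝒪_{L_i}` (all `λ_i ≠ 0`) is `ψ⁻¹(λ)·(R_I)^∼`, admissible (`packetAdm_smul_normalizedPacket`).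
[cite: Mochizuki2012, IUTchIII Rmk. 3.9.5 (ii) p. 127] -/
theorem packetAdm_preimage_hullSet {j : T.Label} (e : T.Caps j → T.Fibre vQ)
    (c : ∀ i : DIdx p (P.kk e), DFac p (P.kk e) i) (hc : ∀ i, c i ≠ 0) :
    PacketAdm p (P.kk e) (dEquiv p (P.kk e) ⁻¹' hullSet (DFac p (P.kk e)) c) := by
  haveI : Nonempty (T.Caps j) := ⟨0⟩
  set g : P.X e := (dEquiv p (P.kk e)).symm c with hg
  have hgc : dEquiv p (P.kk e) g = c := by rw [hg, AlgEquiv.apply_symm_apply]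
  have hset : dEquiv p (P.kk e) ⁻¹' hullSet (DFac p (P.kk e)) c =
      g • (normalizedPacket p (P.kk e) : Set (P.X e)) := by
    rw [← Set.preimage_image_eq (g • (normalizedPacket p (P.kk e) : Set (P.X e))) (dEquiv p (P.kk e)).injective,
      image_smul_eq, image_normalizedPacket_eq_coe, coe_piUnitBallStructure, hgc, hullSet_eq_image_mul _ c hc]
  rw [hset]
  exact packetAdm_smul_normalizedPacket p (P.kk e) g fun i => by rw [hgc]; exact hc i

/-- The preimage of a hull-set under the field-factor comparison is the preimage under `e` of the direct product
over the summands `v⃗` of the `ψ_{v⃗}⁻¹(Π_i λ_{v⃗,i}·𝒪)`. [folklore] -/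
theorem factorMap_preimage_hullSet (j : T.Label) (c : ∀ s : P.factorIdx j, P.factorField j s) :
    (fun x => P.factorMap j x) ⁻¹' hullSet (P.factorField j) c =
      P.comparison j ⁻¹' Set.pi univ fun e =>
        dEquiv p (P.kk e) ⁻¹' hullSet (DFac p (P.kk e)) fun i => c ⟨e, i⟩ := by
  ext x
  simp only [Set.mem_preimage, hullSet, mem_polydisc, Set.mem_univ_pi, Sigma.forall]
  rfl

/-- **Hull-sets are admissible in the verbatim container** (the binder `hadm` of c312-7's
`Setting.ofComparison`, for the field-factor comparison of a `p`-adic presentation): the preimage of `λ·𝒪_L` is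
a direct product over the summands of sets of positive finite normalised Haar measure ([IUTchIII] Rmk. 3.9.5 (ii)
"`λ·𝒪 ∈ 𝕄(𝓘^ℚ(−))`"; Rmk. 3.1.1 (iii)). [claim: Mochizuki2012, status: disputed] -/
theorem adm_preimage_of_isHullSet (j : T.Label) {H : Set (∀ s : P.factorIdx j, P.factorField j s)}
    (hH : IsHullSet (P.factorField j) H) : P.toLocalPieces.Adm j ((fun x => P.factorMap j x) ⁻¹' H) := by
  obtain ⟨c, hc, rfl⟩ := hH
  rw [factorMap_preimage_hullSet]
  exact ⟨_, Set.image_preimage_eq _ (P.comparison_surjective j),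
    fun e => P.packetAdm_preimage_hullSet e _ fun i => hc ⟨e, i⟩⟩

end PadicPresentation

end Cor312Vol

namespace Thm311

namespace Real

open Cor312 Cor312Vol Literature.IUT.LogThetaLattice Literature.IUT.LogVolume

variable {F : Type} [Field F] [NumberField F] (X : PilotData F) {logv : PadicLogs F} (hlog : LogvAnalytic logv)

/-! ## The field-factor pieces of the real Dupuy–Hilado-level signature at every place -/

/-- The `p`-adic presentation at the prime `pp` (parent file), with its `Fact` instance supplied. [folklore] -/
abbrev presAt (pp : Nat.Primes) :
    haveI : Fact (pp : ℕ).Prime := ⟨pp.2⟩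
    PadicPresentation (logShellsDH X logv) (.inr pp) pp.1 :=
  haveI : Fact (pp : ℕ).Prime := ⟨pp.2⟩
  padicPresentationDH X pp.1 logv (hlog pp)

/-- Field-factor index per `(j, v_ℚ)`: `Σ_{v⃗} DIdx` at a prime ([IUTchIV] Prop. 1.4 (i); Dupuy–Hilado Def. 3.6.1
for the summands at finite `p`), EMPTY at the archimedean place — the modelling choice of the parent file's trivial
archimedean container (`LocalPieces.trivial`, `Cor312VolumesRealAssembly`); NOT Dupuy–Hilado's Def. 3.6.1, which
keeps `p = ∞`. [claim: Mochizuki2012, status: disputed] -/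
def factorIdxDH : ∀ (j : (thetaIndex X).Label) (vQ : (thetaIndex X).VQ), Type
  | _, .inl _ => PEmpty
  | j, .inr pp => haveI : Fact (pp : ℕ).Prime := ⟨pp.2⟩; (presAt X hlog pp).factorIdx j

/-- … is finite. [folklore] -/
@[reducible] def factorIdxDH_fintype : ∀ (j : (thetaIndex X).Label) (vQ : (thetaIndex X).VQ), Fintype (factorIdxDH X hlog j vQ)
  | _, .inl _ => inferInstanceAs (Fintype PEmpty)
  | j, .inr pp => by
    haveI : Fact (pp : ℕ).Prime := ⟨pp.2⟩
    haveI : Fintype ((thetaIndex X).Caps j → (thetaIndex X).Fibre (.inr pp)) := Fintype.ofFinite _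
    exact inferInstanceAs (Fintype (Σ e : (thetaIndex X).Caps j → (thetaIndex X).Fibre (.inr pp),
      DIdx pp.1 ((presAt X hlog pp).kk e)))

/-- The field factors: c312-3's `DFac` at a prime, none at `∞`. [cite: Mochizuki2012, IUTchIV Prop. 1.4 (i) p. 13] -/
def factorFieldDH : ∀ (j : (thetaIndex X).Label) (vQ : (thetaIndex X).VQ), factorIdxDH X hlog j vQ → Type
  | _, .inl _ => fun s => s.elim
  | j, .inr pp => haveI : Fact (pp : ℕ).Prime := ⟨pp.2⟩; fun s => (presAt X hlog pp).factorField j s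

/-- … are nontrivially normed fields. [folklore] -/
@[reducible] def factorFieldDH_field : ∀ (j : (thetaIndex X).Label) (vQ : (thetaIndex X).VQ) (s : factorIdxDH X hlog j vQ),
    NontriviallyNormedField (factorFieldDH X hlog j vQ s)
  | _, .inl _, s => s.elim
  | _, .inr pp, s => by
    haveI : Fact (pp : ℕ).Prime := ⟨pp.2⟩
    exact inferInstanceAs (NontriviallyNormedField (DFac pp.1 _ s.2))

/-- … ultrametric. [folklore] -/
theorem factorFieldDH_ultra : ∀ (j : (thetaIndex X).Label) (vQ : (thetaIndex X).VQ) (s : factorIdxDH X hlog j vQ),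
    @IsUltrametricDist (factorFieldDH X hlog j vQ s) (factorFieldDH_field X hlog j vQ s).toNormedField.toMetricSpace.toDist
  | _, .inl _, s => s.elim
  | _, .inr pp, s => by
    haveI : Fact (pp : ℕ).Prime := ⟨pp.2⟩
    exact isUltrametricDist_dFac pp.1 _ s.2

/-- … proper. [folklore] -/
theorem factorFieldDH_proper : ∀ (j : (thetaIndex X).Label) (vQ : (thetaIndex X).VQ) (s : factorIdxDH X hlog j vQ),
    @ProperSpace (factorFieldDH X hlog j vQ s)
      (factorFieldDH_field X hlog j vQ s).toNormedField.toMetricSpace.toPseudoMetricSpace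
  | _, .inl _, s => s.elim
  | _, .inr pp, s => by
    haveI : Fact (pp : ℕ).Prime := ⟨pp.2⟩
    exact properSpace_dFac pp.1 _ s.2

attribute [instance] factorIdxDH_fintype factorFieldDH_field factorFieldDH_ultra factorFieldDH_proper

/-- The field-factor comparison `𝓘^ℚ(^{S^±_{j+1}};𝒟^⊢_{v_ℚ}) → Π_{(v⃗,i)} L_{v⃗,i}`. [claim: Mochizuki2012, status: disputed] -/
def factorMapDH : ∀ (j : (thetaIndex X).Label) (vQ : (thetaIndex X).VQ),
    (logShellsDH X logv).Packet j vQ → ∀ s : factorIdxDH X hlog j vQ, factorFieldDH X hlog j vQ s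
  | _, .inl _ => fun _ s => s.elim
  | j, .inr pp => haveI : Fact (pp : ℕ).Prime := ⟨pp.2⟩; fun x s => (presAt X hlog pp).factorMap j x s

section Setting

variable (M : Type) [Field M] [NumberField M]
  (archPk : ∀ (j : (thetaIndex X).Label) (vQ : (thetaIndex X).VQ), Set ((logShellsDH X logv).Packet j vQ))
  (archSub : ∀ (j : (thetaIndex X).Label) (v : (thetaIndex X).V),
    Set ((logShellsDH X logv).Packet j ((thetaIndex X).over v)))
  (Ψ : ℤ → ∀ v : (thetaIndex X).V, v ∈ (thetaIndex X).Vbad → Set ((logShellsDH X logv).StarPacket v))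
  (act : ℤ → ∀ v : (thetaIndex X).V, v ∈ (thetaIndex X).Vbad →
    (logShellsDH X logv).StarPacket v → Module.End ℚ ((logShellsDH X logv).StarPacket v))
  (Mmod : ℤ → ∀ j : (thetaIndex X).LabelStar, Set ((logShellsDH X logv).GlobalPacket j.1))
  (region : ℤ → ∀ j : (thetaIndex X).LabelStar, FinDivisor M → ∀ vQ : (thetaIndex X).VQ,
    Set ((logShellsDH X logv).Packet j.1 vQ))

/-- **The real field-factor pieces** of the setting over `Real.situationDHVol`: the factors, the comparison, and
the two pilot binders (Θ-boxes, `q`-centre). [claim: Mochizuki2012, status: disputed] -/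
def realPiecesDH {ObLgp ObΔ : Type}
    (thetaBox : ℤ → ObLgp → ∀ (j : (thetaIndex X).Label) (vQ : (thetaIndex X).VQ),
      Set (∀ s : factorIdxDH X hlog j vQ, factorFieldDH X hlog j vQ s))
    (qCentre : ObΔ → ∀ (j : (thetaIndex X).Label) (vQ : (thetaIndex X).VQ),
      ∀ s : factorIdxDH X hlog j vQ, factorFieldDH X hlog j vQ s) :
    Setting.RealPieces (situationDHVol X hlog M archPk archSub Ψ act Mmod region) ObLgp ObΔ where
  J := factorIdxDH X hlog
  instFintype := factorIdxDH_fintype X hlog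
  K := factorFieldDH X hlog
  instField := factorFieldDH_field X hlog
  instUltra := factorFieldDH_ultra X hlog
  instProper := factorFieldDH_proper X hlog
  e := factorMapDH X hlog
  thetaBox := thetaBox
  qCentre := qCentre

/-- **`hadm` DISCHARGED for the real log-shells with the verbatim volumes**: the preimage of every hull-set
`λ·𝒪_L` of every real packet is an admissible region of every line of `situationDHVol` ([IUTchIII] Rmk. 3.9.5
(ii); at a prime by `adm_preimage_of_isHullSet`, at `∞` trivially). [claim: Mochizuki2012, status: disputed] -/
theorem hadm_DH (n : ℤ) : ∀ (j : (thetaIndex X).Label) (vQ : (thetaIndex X).VQ)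
    (H : Set (∀ s : factorIdxDH X hlog j vQ, factorFieldDH X hlog j vQ s)),
    IsHullSet (factorFieldDH X hlog j vQ) H →
      ((situationDHVol X hlog M archPk archSub Ψ act Mmod region).D n).Adm j vQ (factorMapDH X hlog j vQ ⁻¹' H)
  | j, .inl u, H, hH => by
    refine (LocalPieces.adm_trivial_iff (logShellsDH X logv) (.inl u) j _).2 ⟨0, ?_⟩
    obtain ⟨c, -, rfl⟩ := hH
    show factorMapDH X hlog j (.inl u) 0 ∈ hullSet _ c
    rw [hullSet, mem_polydisc]
    exact fun s => s.elim
  | j, .inr pp, H, hH => by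
    haveI : Fact (pp : ℕ).Prime := ⟨pp.2⟩
    exact (presAt X hlog pp).adm_preimage_of_isHullSet j hH

variable (n : ℤ) {HT : Type} {LogLink : HT → HT → Type} {IsFull : ∀ {s t : HT}, LogLink s t → Prop}
  (lat : LGPGaussianLogThetaLattice LogLink IsFull)
  {Frd : Type} {IsoF : Frd → Frd → Type} {Ob : Frd → Type} {realify : Frd → Frd} {Strip : Type}
  {IsoS : Strip → Strip → Type} {Mv : ∀ v : (thetaIndex X).V, v ∈ (thetaIndex X).Vbad → Type}
  [∀ v h, Monoid (Mv v h)]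
  (sig : GlobalLGPFrobenioidSignature (thetaIndex X).lstar (thetaIndex X).V (· ∈ (thetaIndex X).Vbad)
    Frd IsoF Ob realify Strip IsoS Mv)
  (split : SplittingMonoids Mv) {ObΔ : Type} {N : ∀ v : (thetaIndex X).V, v ∈ (thetaIndex X).Vbad → Type}
  [∀ v h, Monoid (N v h)] (qData : QPilotData ObΔ N)
  (thetaBox : ℤ → Ob sig.Clgp → ∀ (j : (thetaIndex X).Label) (vQ : (thetaIndex X).VQ),
    Set (∀ s : factorIdxDH X hlog j vQ, factorFieldDH X hlog j vQ s))
  (qCentre : ObΔ → ∀ (j : (thetaIndex X).Label) (vQ : (thetaIndex X).VQ),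
    ∀ s : factorIdxDH X hlog j vQ, factorFieldDH X hlog j vQ s)
  (hq : ∀ j vQ s, qCentre (qPilotObject qData) j vQ s ≠ 0)
  (hfin : ∀ j : (thetaIndex X).Label, (Function.support fun vQ =>
    ((situationDHVol X hlog M archPk archSub Ψ act Mmod region).D n).logvol j vQ
      (factorMapDH X hlog j vQ ⁻¹' hullSet (factorFieldDH X hlog j vQ) (qCentre (qPilotObject qData) j vQ))).Finite)

/-- **The setting of [IUTchIII] Cor. 3.12 over the REAL log-shells of `F` with the VERBATIM volumes** (c312-7's
`Setting.ofComparison` at `Real.situationDHVol` with the real field-factor pieces; `hadm` PROVED). Binders left: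
the column `n`, the context data `lat`/`sig`/`split`/`qData`, the Θ-boxes, the `q`-centre with `hq`, `hfin`, and
the situation's archimedean integral structures and (b)(c) data. [claim: Mochizuki2012, status: disputed] -/
def settingDHVol : Cor312.Setting (situationDHVol X hlog M archPk archSub Ψ act Mmod region) :=
  Setting.ofComparison n lat sig split qData (realPiecesDH X hlog M archPk archSub Ψ act Mmod region thetaBox qCentre)
    hq (hadm_DH X hlog M archPk archSub Ψ act Mmod region n) hfin

/-- The column of the assembled setting is `n`. [folklore] -/
theorem settingDHVol_n :
    (settingDHVol X hlog M archPk archSub Ψ act Mmod region n lat sig split qData thetaBox qCentre hq hfin).n = n :=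
  rfl

/-- **`hul_nonempty` DISCHARGED**: every hull-set of every frame of the assembled setting is nonempty (it is an
admissible region of the verbatim container). [folklore] -/
theorem hul_nonempty_settingDHVol (j : (thetaIndex X).Label) (vQ : (thetaIndex X).VQ) :
    ∀ H ∈ ((settingDHVol X hlog M archPk archSub Ψ act Mmod region n lat sig split qData thetaBox qCentre hq
      hfin).frame j vQ).Hul, H.Nonempty := by
  rintro _ ⟨H', hH', rfl⟩
  have h := hadm_DH X hlog M archPk archSub Ψ act Mmod region n j vQ H' hH'
  exact SummandPieces.Adm.nonempty ((realizes_situationDHVol X hlog M archPk archSub Ψ act Mmod region n).adm_iff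
    j vQ _ |>.1 h)

/-- **c312-6's `BridgeHyps` for the real setting with the verbatim volumes**, with `mono`, `image_adm`,
`image_fin`, `hul_nonempty`, `theta_nonempty` DISCHARGED: it remains to supply admissibility of the (Ind3)-enlarged
Θ-region at the labels `j ∈ 𝔽_l^⋇` (a property of the binder `thetaBox`: the union over `m` of the Θ-boxes pulls
back to a direct product over the summands of positive-finite-measure sets — owner c312-3 `Ind3Datum`) with finitely
supported log-volume, and `ThetaFinite` (c312-7 `hullDefined_of_stable`). [claim: Mochizuki2012, status: disputed] -/
theorem bridgeHyps_settingDHVol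
    (hθ : ∀ (i : Fin (thetaIndex X).lstar) (vQ : (thetaIndex X).VQ),
      ((situationDHVol X hlog M archPk archSub Ψ act Mmod region).D n).Adm _ vQ
        ((settingDHVol X hlog M archPk archSub Ψ act Mmod region n lat sig split qData thetaBox qCentre hq
          hfin).thetaRegion3 (Setting.labelSucc i) vQ))
    (hfinθ : ∀ i : Fin (thetaIndex X).lstar, (Function.support fun vQ : (thetaIndex X).VQ =>
      ((situationDHVol X hlog M archPk archSub Ψ act Mmod region).D n).logvol _ vQ
        ((settingDHVol X hlog M archPk archSub Ψ act Mmod region n lat sig split qData thetaBox qCentre hq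
          hfin).thetaRegion3 (Setting.labelSucc i) vQ)).Finite)
    (finite : (settingDHVol X hlog M archPk archSub Ψ act Mmod region n lat sig split qData thetaBox qCentre hq
      hfin).ThetaFinite) :
    BridgeHyps (settingDHVol X hlog M archPk archSub Ψ act Mmod region n lat sig split qData thetaBox qCentre hq
      hfin) :=
  bridgeHyps_DH X hlog M archPk archSub Ψ act Mmod region _ hθ hfinθ
    (hul_nonempty_settingDHVol X hlog M archPk archSub Ψ act Mmod region n lat sig split qData thetaBox qCentre hq
      hfin) finite

end Setting

end Real

end Thm311

end IUTFork

end Summit.ABC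

end
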